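import Literature.AlgebraicGeometry.Frobenioids.PadicFrobenioidBaseTransport
import Literature.AlgebraicGeometry.Frobenioids.PadicFrobenioidDatumLemmas
import Mathlib.CategoryTheory.EssentialImage
import HarnessLib

/-!
# Frobenioids II, Example 1.1 (ii): the essential image of `C^⊢ ⊆ C` — the Frobenius-trivial objects (over `D^⊢`)

Mochizuki, *The geometry of Frobenioids II*, Kyushu J. Math. **62** (2008) 401–460, §1, Example 1.1 (ii), p. 8
[cite: MochizukiFrdII2008, Ex 1.1 (ii) p.8] and Theorem 1.2 (v), p. 9 ("if `Φ` is absolutely primitive, then the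
homomorphism `B → Φ^gp` … is surjective … `C` is of base-trivial type") [cite: MochizukiFrdII2008, Thm 1.2 (v) p.9].
Consumed by [IUTchI] Ex. 3.3 (i)/(iii) (d) ("`C_v^⊢ ⊆ C_v` … which may be thought of as a subcategory of `C_v`";
"(d) the category `C⊢_v` may be reconstructed category-theoretically from `F̲_v`").

PROOF-ONLY file (abc-iut cell, seat abc-iut-L1-t4; companion of `PadicFrobenioidCdashHomImage.lean`, which describes
the image of `C^⊢ ⊆ C` on HOM-sets), 0 definitions. It describes the image on OBJECTS, for the REAL objects of this
directory:
* `Datum.prim_nonempty_iso_zeroObj` — in the absolutely primitive `p`-adic Frobenioid `C^⊢` every object `(A, α)` is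
  isomorphic to the Frobenius-trivial object `(A, 0)` over the same base (`Div_B : B^⊢ → (Φ^⊢)^gp` is surjective,
  Thm. 1.2 (v));
* `GoodLocalKit.CdashToC_obj_zeroObj` / `CdashToCOver_obj_zeroObj` — `C^⊢ ⊆ C` (one base) and `C_v^⊢ → C_v` (two bases
  `D_v^⊢ ⊆ D_v`) map `(A, 0)` to `(A, 0)`, resp. `(incl A, 0)` (on the nose);
* `GoodLocalKit.CdashToC_essImage_iff` — the essential image of `C^⊢ ⊆ C` consists of the objects `Z` isomorphic to
  `(Base Z, 0)` ("Frobenius-trivial"); `GoodLocalKit.CdashToCOver_essImage_iff` — the essential image of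
  `C_v^⊢ → C_v` consists of the objects `Z` whose base lies in the essential image of `incl : D_v^⊢ → D_v` and which
  are isomorphic to `(Base Z, 0)`.
So the input `hobj` of abc-iut-w4-d047's non-full reconstructibility socket for [IUTchI] Ex. 3.3 (iii) (d)
(`GoodLocalFrobenioid.cdashFromF_of_morphismProperty`) reads: every self-equivalence of `C_v` carries each
`(incl A, 0)` to an object with base in the essential image of `D_v^⊢ ⊆ D_v` that is isomorphic to the zero object over
its own base. No statement of the paper is strengthened; nothing here bears on [IUTchIII].
-/

namespace Literature.AlgebraicGeometry.Frobenioids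

namespace PadicFrd

open CategoryTheory Opposite Function

/-! ### `C^⊢`: every object is isomorphic to the Frobenius-trivial object over its base -/

section Prim

universe v u

variable {D : Type u} [Category.{v} D] {p : ℕ} [Fact p.Prime] (base : D ⥤ PadicFld.{u} p)
  (hloc : ∀ A : D, (base.obj A).IsPadicLocal) (hc : IsConnected D) (he : IsTotallyEpimorphic D)

/-- In the absolutely primitive `p`-adic Frobenioid `C^⊢` every object `(A, α)` is isomorphic to the
Frobenius-trivial object `(A, 0)`: `Div_B : B^⊢(A) → Φ^⊢(A)^gp = ℤ · log(p)` is surjective (Thm. 1.2 (v): "`C` is of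
base-trivial type"). [cite: MochizukiFrdII2008, Thm 1.2 (v) p.9] -/
theorem Datum.prim_nonempty_iso_zeroObj (t : (Datum.prim base hloc hc he).frobenioid) :
    Nonempty (t ≅ ModelFrobenioid.zeroObj _ _ (Datum.prim base hloc hc he).divB t.base) := by
  obtain ⟨i⟩ := ModelFrobenioid.isBaseTrivial_of_divB_surjective
    (fun A b => (Datum.prim base hloc hc he).isUnit_B (op A) b)
    ((Datum.prim base hloc hc he).divB_surjective_of_isAbsolutelyPrimitive
      (Datum.prim_isAbsolutelyPrimitive base hloc hc he))
    t (ModelFrobenioid.zeroObj _ _ (Datum.prim base hloc hc he).divB t.base) ⟨Iso.refl _⟩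
  exact ⟨i.symm⟩

end Prim

namespace GoodLocalKit

universe v v' u

variable {D : Type u} [Category.{v} D] {p : ℕ} [Fact p.Prime] (base : D ⥤ PadicFld.{u} p)
  (hloc : ∀ A : D, (base.obj A).IsPadicLocal) (hc : IsConnected D) (he : IsTotallyEpimorphic D)

/-! ### One base: the essential image of `C_v^⊢ ⊆ C_v` -/

/-- `C_v^⊢ ⊆ C_v` maps the Frobenius-trivial object `(A, 0)` to `(A, 0)`. [cite: MochizukiFrdII2008, Ex 1.1 (ii) p.8] -/
theorem CdashToC_obj_zeroObj (A : D) :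
    (CdashToC base hloc hc he).obj (ModelFrobenioid.zeroObj _ _ (Datum.prim base hloc hc he).divB A) =
      ModelFrobenioid.zeroObj _ _ (Datum.perf base hloc hc he).divB A :=
  congrArg (ModelFrobenioid.mk A) (map_one (gpApp (Datum.primToPerf base hloc hc he).η (op A)))

/-- **The essential image of `C_v^⊢ ⊆ C_v`** consists of the objects `Z = (A, α)` of `C_v` isomorphic to the
Frobenius-trivial object `(A, 0)` over their own base (i.e. `α ∈ Div_B(B(A)) = ord(K_A^×)`).
[cite: MochizukiFrdII2008, Ex 1.1 (ii) p.8] -/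
theorem CdashToC_essImage_iff (Z : Cv base hloc hc he) :
    (CdashToC base hloc hc he).essImage Z ↔
      Nonempty (Z ≅ ModelFrobenioid.zeroObj _ _ (Datum.perf base hloc hc he).divB Z.base) := by
  constructor
  · rintro ⟨t, ⟨i⟩⟩
    obtain ⟨j⟩ := Datum.prim_nonempty_iso_zeroObj base hloc hc he t
    -- `Z ≅ C(t) ≅ C((t.base, 0)) = (t.base, 0) ≅ (Z.base, 0)` (the last along `Base(i) : t.base ≅ Z.base`)
    let b : t.base ≅ Z.base := (ModelFrobenioid.baseFunctor _ _ (Datum.perf base hloc hc he).divB).mapIso i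
    exact ⟨i.symm ≪≫ (CdashToC base hloc hc he).mapIso j ≪≫ eqToIso (CdashToC_obj_zeroObj base hloc hc he t.base) ≪≫
      (ModelFrobenioid.zeroSection _ _ (Datum.perf base hloc hc he).divB).mapIso b⟩
  · rintro ⟨k⟩
    exact ⟨ModelFrobenioid.zeroObj _ _ (Datum.prim base hloc hc he).divB Z.base,
      ⟨eqToIso (CdashToC_obj_zeroObj base hloc hc he Z.base) ≪≫ k.symm⟩⟩

/-! ### Two bases `D_v^⊢ ⊆ D_v`: the essential image of `C_v^⊢ → C_v` -/

variable {Dv : Type u} [Category.{v'} Dv] (proj : Dv ⥤ D)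
  (hlocv : ∀ A : Dv, ((proj ⋙ base).obj A).IsPadicLocal) (hcv : IsConnected Dv) (hev : IsTotallyEpimorphic Dv)
  (incl : D ⥤ Dv) (ε : incl ⋙ proj ⟶ 𝟭 D)

/-- `C_v^⊢ → C_v` (two bases) maps the Frobenius-trivial object `(A, 0)` to `(incl A, 0)` (the transport along `ε`
of the trivial class is trivial). [cite: MochizukiFrdII2008, Ex 1.1 (ii) p.8] -/
theorem CdashToCOver_obj_zeroObj (A : D) :
    (CdashToCOver base hloc hc he proj hlocv hcv hev incl ε).obj
        (ModelFrobenioid.zeroObj _ _ (Datum.prim base hloc hc he).divB A) =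
      ModelFrobenioid.zeroObj _ _ (Datum.perf (proj ⋙ base) hlocv hcv hev).divB (incl.obj A) := by
  -- `ε_A` retyped over `proj (incl A) ⟶ A` (so that the rewrites below see matching types)
  let e : proj.obj (incl.obj A) ⟶ A := ε.app A
  have h : pullGp (Datum.perf base hloc hc he).Φ e (gpApp (Datum.primToPerf base hloc hc he).η (op A) 1) = 1 := by
    rw [map_one, map_one]
  exact congrArg (ModelFrobenioid.mk (incl.obj A)) h

/-- **The essential image of `C_v^⊢ → C_v` (two bases)** consists of the objects `Z` of `C_v` whose base lies in the
essential image of `incl : D_v^⊢ → D_v` and which are isomorphic to the Frobenius-trivial object `(Base Z, 0)`.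
Hence the input `hobj` of the reconstructibility socket for [IUTchI] Ex. 3.3 (iii) (d) says: self-equivalences of
`C_v` carry each `(incl A, 0)` to such an object. [cite: MochizukiFrdII2008, Ex 1.1 (ii) p.8] -/
theorem CdashToCOver_essImage_iff (Z : CvOver base proj hlocv hcv hev) :
    (CdashToCOver base hloc hc he proj hlocv hcv hev incl ε).essImage Z ↔
      incl.essImage Z.base ∧
        Nonempty (Z ≅ ModelFrobenioid.zeroObj _ _ (Datum.perf (proj ⋙ base) hlocv hcv hev).divB Z.base) := by
  constructor
  · rintro ⟨t, ⟨i⟩⟩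
    obtain ⟨j⟩ := Datum.prim_nonempty_iso_zeroObj base hloc hc he t
    -- `Z ≅ C(t) ≅ C((t.base, 0)) = (incl t.base, 0)`
    let k : Z ≅ ModelFrobenioid.zeroObj _ _ (Datum.perf (proj ⋙ base) hlocv hcv hev).divB (incl.obj t.base) :=
      i.symm ≪≫ (CdashToCOver base hloc hc he proj hlocv hcv hev incl ε).mapIso j ≪≫
        eqToIso (CdashToCOver_obj_zeroObj base hloc hc he proj hlocv hcv hev incl ε t.base)
    let b : Z.base ≅ incl.obj t.base :=
      (ModelFrobenioid.baseFunctor _ _ (Datum.perf (proj ⋙ base) hlocv hcv hev).divB).mapIso k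
    exact ⟨⟨t.base, ⟨b.symm⟩⟩,
      ⟨k ≪≫ (ModelFrobenioid.zeroSection _ _ (Datum.perf (proj ⋙ base) hlocv hcv hev).divB).mapIso b.symm⟩⟩
  · rintro ⟨⟨A, ⟨b⟩⟩, ⟨k⟩⟩
    -- `C((A, 0)) = (incl A, 0) ≅ (Z.base, 0) ≅ Z`
    exact ⟨ModelFrobenioid.zeroObj _ _ (Datum.prim base hloc hc he).divB A,
      ⟨eqToIso (CdashToCOver_obj_zeroObj base hloc hc he proj hlocv hcv hev incl ε A) ≪≫
        (ModelFrobenioid.zeroSection _ _ (Datum.perf (proj ⋙ base) hlocv hcv hev).divB).mapIso b ≪≫ k.symm⟩⟩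

end GoodLocalKit

end PadicFrd

end Literature.AlgebraicGeometry.Frobenioids
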